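import Summits.BirchSwinnertonDyer.BirchSwinnertonDyer.Theorems.ClassRecordThreeCartanSupplyDoubleCosetDockings
import HarnessLib

/-!
# (HF♭) the Hecke family PROVED and (MO1) ⟹ (L1S) — §I.4 of the `doublecoset` certificate for crux 24801 `CartanOnePlaceDegreeLawAtThree`

Lift-only port (cell bsd-stepL, SUMMON key `k5-lift1`, director-bsd (734)(1) CONCUR 2026-08-31) of §I.4 (source lines 2572–2736) of the crux-ideate workfile
`Summits/BirchSwinnertonDyer/BirchSwinnertonDyer/Cruxes/CartanOnePlaceDegreeLawAtThree/Lines/doublecoset.lean` (lineage `cruxidea-stmt-BirchSwinnertonDyer-24801-1`, generation 22,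
commit 721e9ccbdf4b, sha256-16 d3adee7328f6a76c, 2876 l.; farm rc 0, sorries 4 = its §4 stubs, none of which is lifted; referee landing record `VERDICT-DOUBLECOSET-G22-g88.md`).
Declarations, statements and proofs below are BYTE-IDENTICAL to the source; the only edits are the namespace (`…Cruxes.CartanOnePlaceDegreeLawAtThree.Doublecoset` ↦
`…Theorems.CartanDoubleCoset`, shared by the nine `ClassRecordThreeCartanSupply*` modules), the imports ∕ `open`s each module needs, and one-line docstrings added where the source
had none. Nothing is re-stated, weakened or re-proved.

CONTENT (generation 22, real proofs). (HF♭) `CoverHeckeFamilyFn` — the function-valued twin of (HF) — and `coverHeckeFamilyFn_holds : CoverHeckeFamilyFn` (PROVED: the family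
`heckeFamilyFn` = `𝒯♭_ℓ` at good `ℓ`, `0` elsewhere); the ladder (HF) ⟹ (HF♭) (`coverHeckeFamilyFn_of_coverHeckeFamily`); the cut re-threaded through (HF♭)
(`eigenFn_of_mem_spanG`, `eigenFn_of_mem_sup_spanG`, `fixed_dependent_of_eigenModuleFn`, `splitFixedRankOne_of_heckeFamilyFn`) and the net gain
`splitFixedRankOne_of_multiplicityOne : SplitLevelMultiplicityOne → SplitFixedRankOne` — (L1S) UNCONDITIONALLY IN (HF). Route-independent (imports `…DoubleCosetDockings` only);
the §5 compositions BY NAME (which need the route files) live in the leaf module `ClassRecordThreeCartanSupplyCompositions`. NB the port is TEN modules, not nine as the shared custody paragraph says: the §5 compositions were split off `…HeckeFamily` into the leaf module `ClassRecordThreeCartanSupplyCompositions` at landing time (gate `lint.theses-cone`).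

HONEST: a `--supports stmt-BirchSwinnertonDyer-24801` helper module; it proves NOTHING about NUM ∕ NUM♮ (items 24801 ∕ 32276) or crux 19109 for any curve — the leaves (MO1)
`SplitLevelMultiplicityOne`, (BCV) `BorelCubicEigenDocking`, (VAN) `NonsplitTorusCubicVanishing`, (DS) ∧ (JLᶜ) stay OPEN; registry `Lines/petarea.lean` rev 8 untouched; BSD is proved for no curve.
-/

set_option linter.dupNamespace false  -- `Summit.BirchSwinnertonDyer.BirchSwinnertonDyer.…` (summit = problem), as every file of this directory
set_option autoImplicit false

noncomputable section

open scoped Classical MatrixGroups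
open Matrix

namespace Summit.BirchSwinnertonDyer.BirchSwinnertonDyer.Theorems.CartanDoubleCoset

open Summit.BirchSwinnertonDyer.BirchSwinnertonDyer.Theorems
open Summit.BirchSwinnertonDyer.BirchSwinnertonDyer.Theorems.CartanDegree (HasRatEigenvalue)
open Summit.BirchSwinnertonDyer.BirchSwinnertonDyer.Theorems.CartanTorusCubeCut (torusSubgroup mem_torusSubgroup lin linGL linGL_coe lin_comm torusSubgroup_isCyclic card_torusSubgroup)
open Summit.BirchSwinnertonDyer.BirchSwinnertonDyer.Theorems.CartanCover (splitGen mem_splitTorus_iff)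
open Summit.BirchSwinnertonDyer.BirchSwinnertonDyer.Theorems.CartanCover.Charext.InertHecke (upperUnip lowerUnip coe_upperUnip coe_lowerUnip upperUnip_mul upperUnip_zero exists_unip_factorization)
open scoped Pointwise ModularForm NumberField
open Module UpperHalfPlane
open Literature.NumberTheory.Automorphic WeierstrassCurve Literature.NumberTheory.EllipticCurves Literature.NumberTheory.EllipticCurves.ModularForms
open Literature.NumberTheory.EllipticCurves.Rank1Residual Summit.BirchSwinnertonDyer.Rank1Residual Literature.NumberTheory.GaloisRepresentations NumberField IsDedekindDomain
open Summit.BirchSwinnertonDyer.BirchSwinnertonDyer.Theorems.CartanCover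
open Summit.BirchSwinnertonDyer.BirchSwinnertonDyer.Theorems.CartanCover.CMRank
open Summit.BirchSwinnertonDyer.BirchSwinnertonDyer.Theorems.CartanTorusCubeCut
open Summit.BirchSwinnertonDyer.BirchSwinnertonDyer.Theorems.CartanDegree (cubicNewvectorChar HasRatEigenvalue)

/-! ### §I.4 (HF♭): the function-valued twin of (HF), PROVED; the ladder (HF) ⟹ (HF♭); (M1S♭) ⟹ (L1S′♭) re-threaded through (HF♭) -/

section HeckeCut

variable {D M : ℕ} {C : Finset ℕ} {X : CartanLevelCurveData D M C} {q : ℕ} [Fact q.Prime]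

/-- **(HF♭) — the induced module carries a compatible Hecke family, FUNCTION-VALUED form.** Word for word (HF) of generation 21 with the family
valued in `GL₂(𝔽_q) → ℍ → ℂ` instead of `IndCuspForm` endomorphisms (`rTrans` replaces `indRep`, `coeLin` the identity); PROVED below
(`coverHeckeFamilyFn_holds`), and implied by (HF) (`coverHeckeFamilyFn_of_coverHeckeFamily`). -/
def CoverHeckeFamilyFn : Prop :=
  ∀ (D M : ℕ) (C : Finset ℕ) (X : CartanLevelCurveData D M C) (q : ℕ) [Fact q.Prime] (hq : q ∈ C) (R : CoverReduction X q)
    (Os : Submodule ℤ X.B) (hOs : Brandt.IsOrder X.B Os),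
    (∀ m : Matrix (Fin 2) (Fin 2) ℝ, (∃ x ∈ Os, X.ι x = m) ↔
      ∃ y : coverSubring X q, (R.red y) 0 1 = 0 ∧ (R.red y) 1 0 = 0 ∧ X.ι (y : X.B) = m) →
    ∃ 𝒯 : ℕ → (R.IndCuspForm →ₗ[ℂ] (GL (Fin 2) (ZMod q) → ℍ → ℂ)),
      (∀ (ℓ : ℕ) (g : GL (Fin 2) (ZMod q)) (f : R.IndCuspForm), 𝒯 ℓ (R.indRep g f) = rTrans g (𝒯 ℓ f)) ∧
      (∀ ℓ : ℕ, ℓ.Prime → ¬ ℓ ∣ q * (D * M * ∏ p ∈ C, p) → ∀ (F : CuspForm X.Gamma 2) (a : ℂ),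
        (X.heckeFun ℓ F = fun τ => a * F τ) → 𝒯 ℓ (R.dockNonsplit hq F) = a • coeLin R (R.dockNonsplit hq F)) ∧
      (∀ ℓ : ℕ, ℓ.Prime → ¬ ℓ ∣ q * (D * M * ∏ p ∈ C, p) →
        ∀ (F : CuspForm (R.levelOf (CartanTorusCubeCut.torusSubgroup (splitGen q))) 2) (a : ℂ),
          (unitsHeckeFun X.ι hOs ℓ (⇑F) = fun τ => a * F τ) ↔
            𝒯 ℓ (R.dockTorus (CartanTorusCubeCut.torusSubgroup (splitGen q)) F) =
              a • coeLin R (R.dockTorus (CartanTorusCubeCut.torusSubgroup (splitGen q)) F))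

/-- **THE FAMILY**: `𝒯♭_ℓ` (on a choice of SIMREP data) at the good primes, `0` elsewhere. -/
def heckeFamilyFn (hq : q ∈ C) (R : CoverReduction X q) (ℓ : ℕ) : R.IndCuspForm →ₗ[ℂ] (GL (Fin 2) (ZMod q) → ℍ → ℂ) :=
  if h : ℓ.Prime ∧ ¬ ℓ ∣ q * (D * M * ∏ p ∈ C, p) then
    (by
      haveI : Fintype (Quotient (X.heckeSetoid ℓ)) := fintypeQuot X h.1 (good_of_good h.2)
      exact (Classical.choice (nonempty_simRep hq h.1 h.2)).heckeLin R)
  else 0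

/-- **(HF♭) HOLDS** — the structural leaf (HF) of generation 21 is DISCHARGED in function-valued form. -/
theorem coverHeckeFamilyFn_holds : CoverHeckeFamilyFn := by
  intro D M C X q _ hq R Os hOs hpres
  refine ⟨heckeFamilyFn hq R, ?_, ?_, ?_⟩
  · intro ℓ g f
    by_cases h : ℓ.Prime ∧ ¬ ℓ ∣ q * (D * M * ∏ p ∈ C, p)
    · letI : Fintype (Quotient (X.heckeSetoid ℓ)) := fintypeQuot X h.1 (good_of_good h.2)
      simp only [heckeFamilyFn, dif_pos h]
      exact SimRep.heckeLin_indRep _ R g f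
    · simp only [heckeFamilyFn, dif_neg h, LinearMap.zero_apply, map_zero]
  · intro ℓ hℓ hgood F a hF
    have h : ℓ.Prime ∧ ¬ ℓ ∣ q * (D * M * ∏ p ∈ C, p) := ⟨hℓ, hgood⟩
    letI : Fintype (Quotient (X.heckeSetoid ℓ)) := fintypeQuot X h.1 (good_of_good h.2)
    simp only [heckeFamilyFn, dif_pos h]
    exact SimRep.heckeLin_dockNonsplit _ R hq F a hF
  · intro ℓ hℓ hgood F a
    have h : ℓ.Prime ∧ ¬ ℓ ∣ q * (D * M * ∏ p ∈ C, p) := ⟨hℓ, hgood⟩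
    letI : Fintype (Quotient (X.heckeSetoid ℓ)) := fintypeQuot X h.1 (good_of_good h.2)
    simp only [heckeFamilyFn, dif_pos h]
    exact SimRep.heckeLin_dockTorus_split_iff _ R hq Os hOs hpres F a

/-- THE LADDER: (HF) ⟹ (HF♭) (compose with `coeLin`, which is injective). -/
theorem coverHeckeFamilyFn_of_coverHeckeFamily (h : CoverHeckeFamily) : CoverHeckeFamilyFn := by
  intro D M C X q _ hq R Os hOs hpres
  obtain ⟨𝒯, hcomm, hii, hiii⟩ := h D M C X q hq R Os hOs hpres
  refine ⟨fun ℓ => coeLin R ∘ₗ 𝒯 ℓ, ?_, ?_, ?_⟩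
  · intro ℓ g f
    rw [LinearMap.comp_apply, hcomm, coeLin_indRep, LinearMap.comp_apply]
  · intro ℓ hℓ hnd F a hF
    rw [LinearMap.comp_apply, hii ℓ hℓ hnd F a hF, map_smul]
  · intro ℓ hℓ hnd F a
    rw [hiii ℓ hℓ hnd F a, LinearMap.comp_apply]
    constructor
    · intro h'; rw [h', map_smul]
    · intro h'; exact coeLin_injective R (by rw [h', map_smul])

/-! #### (M1S) ⟹ (L1S′) re-threaded through (HF♭) — hence UNCONDITIONALLY in (HF) -/

/-- eigenvectors propagate along the span of translates (function-valued family). -/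
theorem eigenFn_of_mem_spanG (R : CoverReduction X q) (𝒯 : R.IndCuspForm →ₗ[ℂ] (GL (Fin 2) (ZMod q) → ℍ → ℂ))
    (hcomm : ∀ (g : GL (Fin 2) (ZMod q)) (f : R.IndCuspForm), 𝒯 (R.indRep g f) = rTrans g (𝒯 f))
    {u : R.IndCuspForm} {a : ℂ} (hu : 𝒯 u = a • coeLin R u) : ∀ w ∈ R.spanG u, 𝒯 w = a • coeLin R w := by
  intro w hw
  change w ∈ Submodule.span ℂ (Set.range fun g : GL (Fin 2) (ZMod q) => R.indRep g u) at hw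
  refine Submodule.span_induction (p := fun F _ => 𝒯 F = a • coeLin R F) ?_ ?_ ?_ ?_ hw
  · rintro _ ⟨g, rfl⟩
    rw [hcomm, hu, map_smul, coeLin_indRep]
  · simp
  · intro x y _ _ hx hy
    rw [map_add, map_add, hx, hy, smul_add]
  · intro c x _ hx
    rw [map_smul, map_smul, hx, smul_comm]

/-- The same on `ℂ[G]·u + ℂ[G]·u'` for two `a`-eigenvectors `u`, `u'` (function-valued family). -/
theorem eigenFn_of_mem_sup_spanG (R : CoverReduction X q) (𝒯 : R.IndCuspForm →ₗ[ℂ] (GL (Fin 2) (ZMod q) → ℍ → ℂ))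
    (hcomm : ∀ (g : GL (Fin 2) (ZMod q)) (f : R.IndCuspForm), 𝒯 (R.indRep g f) = rTrans g (𝒯 f))
    {u u' : R.IndCuspForm} {a : ℂ} (hu : 𝒯 u = a • coeLin R u) (hu' : 𝒯 u' = a • coeLin R u') :
    ∀ w ∈ R.spanG u ⊔ R.spanG u', 𝒯 w = a • coeLin R w := by
  intro w hw
  obtain ⟨y, hy, z, hz, rfl⟩ := Submodule.mem_sup.mp hw
  rw [map_add, map_add, eigenFn_of_mem_spanG R 𝒯 hcomm hu y hy, eigenFn_of_mem_spanG R 𝒯 hcomm hu' z hz, smul_add]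

/-- THE SHAPE OF THE CUT, function-valued: inside a `𝒯♭`-eigenmodule matching `T_ℓ^{O_s}` (iff-docking), two `T_s`-FIXED vectors are proportional,
GIVEN multiplicity one at split level. (Proof = generation 21's `fixed_dependent_of_eigenModule`, verbatim up to the codomain of `𝒯`.) -/
theorem fixed_dependent_of_eigenModuleFn {V : WeierstrassCurve ℚ} [V.IsElliptic] (hMO : SplitLevelMultiplicityOne)
    {N : ℕ} (hq : q ∈ C) (R : CoverReduction X q) (hN : V.conductorNorm ℤ = N) (hDMC : D * M * ∏ p ∈ C, p ^ 2 = N)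
    (Os : Submodule ℤ X.B) (hOs : Brandt.IsOrder X.B Os)
    (hpres : ∀ m : Matrix (Fin 2) (Fin 2) ℝ, (∃ x ∈ Os, X.ι x = m) ↔
      ∃ y : coverSubring X q, (R.red y) 0 1 = 0 ∧ (R.red y) 1 0 = 0 ∧ X.ι (y : X.B) = m)
    (𝒯 : ℕ → (R.IndCuspForm →ₗ[ℂ] (GL (Fin 2) (ZMod q) → ℍ → ℂ)))
    (hiii : ∀ ℓ : ℕ, ℓ.Prime → ¬ ℓ ∣ q * (D * M * ∏ p ∈ C, p) →
        ∀ (F : CuspForm (R.levelOf (CartanTorusCubeCut.torusSubgroup (splitGen q))) 2) (a : ℂ),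
          (unitsHeckeFun X.ι hOs ℓ (⇑F) = fun τ => a * F τ) ↔
            𝒯 ℓ (R.dockTorus (CartanTorusCubeCut.torusSubgroup (splitGen q)) F) =
              a • coeLin R (R.dockTorus (CartanTorusCubeCut.torusSubgroup (splitGen q)) F))
    (𝓜 : Submodule ℂ R.IndCuspForm)
    (h𝓜 : ∀ ℓ : ℕ, ℓ.Prime → ¬ ℓ ∣ q * (D * M * ∏ p ∈ C, p) → ∀ w ∈ 𝓜, 𝒯 ℓ w = (((V.LFunction ℓ : ℤ)) : ℂ) • coeLin R w) :
    ∀ w₁ ∈ 𝓜, ∀ w₂ ∈ 𝓜,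
      (∀ t ∈ CartanTorusCubeCut.torusSubgroup (splitGen q), R.indRep t w₁ = w₁) →
      (∀ t ∈ CartanTorusCubeCut.torusSubgroup (splitGen q), R.indRep t w₂ = w₂) →
      w₁ ≠ 0 → ∃ c : ℂ, w₂ = c • w₁ := by
  intro w₁ hw₁ w₂ hw₂ hfix₁ hfix₂ hne
  set T := CartanTorusCubeCut.torusSubgroup (splitGen q) with hT
  have hfull : ∀ g, g ∈ R.torusCoset T := mem_torusCoset_split R hq
  set F₁ := fixedForm R T w₁ hfix₁ with hF₁
  set F₂ := fixedForm R T w₂ hfix₂ with hF₂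
  have hd₁ : w₁ = R.dockTorus T F₁ := eq_dockTorus_of_fixed R T hfull w₁ hfix₁
  have hd₂ : w₂ = R.dockTorus T F₂ := eq_dockTorus_of_fixed R T hfull w₂ hfix₂
  have hE₁ : ∀ ℓ : ℕ, ℓ.Prime → ¬ ℓ ∣ q * (D * M * ∏ p ∈ C, p) →
      unitsHeckeFun X.ι hOs ℓ (⇑F₁) = fun τ => ((V.LFunction ℓ : ℤ) : ℂ) * F₁ τ := by
    intro ℓ hℓ hnd
    apply (hiii ℓ hℓ hnd F₁ _).mpr
    rw [← hd₁]
    exact h𝓜 ℓ hℓ hnd w₁ hw₁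
  have hE₂ : ∀ ℓ : ℕ, ℓ.Prime → ¬ ℓ ∣ q * (D * M * ∏ p ∈ C, p) →
      unitsHeckeFun X.ι hOs ℓ (⇑F₂) = fun τ => ((V.LFunction ℓ : ℤ) : ℂ) * F₂ τ := by
    intro ℓ hℓ hnd
    apply (hiii ℓ hℓ hnd F₂ _).mpr
    rw [← hd₂]
    exact h𝓜 ℓ hℓ hnd w₂ hw₂
  have hF₁0 : F₁ ≠ 0 := by
    intro h0
    apply hne
    rw [hd₁, h0, dockTorus_zero]
  obtain ⟨c, hc⟩ := hMO V N D M C q X hq R hN hDMC Os hOs hpres F₁ F₂ hE₁ hE₂ hF₁0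
  refine ⟨c, ?_⟩
  rw [hd₂, hd₁]
  exact dockTorus_eq_smul_of_coe R T hc

/-- **THE RE-THREADED CUT: (HF♭) ∧ (MO1) ⟹ (L1S)** — generation 21's `splitFixedRankOne_of_heckeFamily` with (HF♭) in place of (HF). -/
theorem splitFixedRankOne_of_heckeFamilyFn (hHF : CoverHeckeFamilyFn) (hMO : SplitLevelMultiplicityOne) : SplitFixedRankOne := by
  intro V _ _ _ N D M C q _ X W₁ _ Q hq R hN hDMC _ _ _ hQ
  have hLV : V.LFunction = W₁.LFunction := LFunction_eq_of_isIsogenous_holds V W₁ hQ.1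
  have hQe : ∀ ℓ : ℕ, ℓ.Prime → ¬ ℓ ∣ D * M * ∏ p ∈ C, p →
      X.heckeFun ℓ Q.form = fun τ => ((V.LFunction ℓ : ℤ) : ℂ) * Q.form τ := by
    intro ℓ hℓ hnd
    rw [hLV]
    exact Q.hecke_eq ℓ hℓ hnd
  have hgood : ∀ ℓ : ℕ, ¬ ℓ ∣ q * (D * M * ∏ p ∈ C, p) → ¬ ℓ ∣ D * M * ∏ p ∈ C, p :=
    fun ℓ h h' => h (dvd_mul_of_dvd_right h' q)
  refine ⟨?_, ?_⟩
  · intro F hF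
    obtain ⟨Os, hOs, hpres⟩ := exists_splitOrder R
    obtain ⟨𝒯, hcomm, hii, hiii⟩ := hHF D M C X q hq R Os hOs hpres
    refine fixed_dependent_of_eigenModuleFn hMO hq R hN hDMC Os hOs hpres 𝒯 hiii _ ?_
    intro ℓ hℓ hnd
    exact eigenFn_of_mem_sup_spanG R (𝒯 ℓ) (hcomm ℓ) (hii ℓ hℓ hnd Q.form _ (hQe ℓ hℓ (hgood ℓ hnd)))
      (hii ℓ hℓ hnd F _ (hF ℓ hℓ (hgood ℓ hnd)))
  · intro Os hOs hpres F hF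
    obtain ⟨𝒯, hcomm, hii, hiii⟩ := hHF D M C X q hq R Os hOs hpres
    refine fixed_dependent_of_eigenModuleFn hMO hq R hN hDMC Os hOs hpres 𝒯 hiii _ ?_
    intro ℓ hℓ hnd
    exact eigenFn_of_mem_sup_spanG R (𝒯 ℓ) (hcomm ℓ) (hii ℓ hℓ hnd Q.form _ (hQe ℓ hℓ (hgood ℓ hnd)))
      ((hiii ℓ hℓ hnd F _).mp (hF ℓ hℓ hnd))

/-- **(MO1) ⟹ (L1S) UNCONDITIONALLY IN (HF)** — the net gain of this generation: the structural leaf is gone. -/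
theorem splitFixedRankOne_of_multiplicityOne (hMO : SplitLevelMultiplicityOne) : SplitFixedRankOne :=
  splitFixedRankOne_of_heckeFamilyFn coverHeckeFamilyFn_holds hMO

end HeckeCut

end Summit.BirchSwinnertonDyer.BirchSwinnertonDyer.Theorems.CartanDoubleCoset

end
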